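import Literature.Analysis.UnboundedOperators.FourierSpectrum
import Literature.MathematicalPhysics.QuantumFieldTheory.LorentzSpectralSupport
import HarnessLib

/-!
# The Fourier spectrum of a unitary representation: support facts (proofs)

Topic `Literature/Analysis/UnboundedOperators`, proof companion of `FourierSpectrum.lean`. With the
linearity and continuity of the Fourier-transformed matrix coefficients now proved there
(`fourierMatrixCoeff_add_holds`, `fourierMatrixCoeff_smul_holds`,
`continuous_fourierMatrixCoeff_holds`), `g ↦ U.fourierMatrixCoeff φ ψ g` is a tempered distribution
(`fourierMatrixCoeffCLM`, **definition**: the bundled continuous linear functional), and the three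
remaining support facts of that file are **discharged**:

* `hasFourierSpectrumIn_fourierSpectrum_holds` — `U` has Fourier spectrum in its Fourier
  spectrum: a tempered distribution vanishes off its distributional support (Hörmander I,
  Thm. 2.2.1: "if `u` vanishes in a neighbourhood of every point of an open set, it vanishes in the
  set" — `isVanishingOn_compl_dsupport`, from the tree's sheaf property of continuous linear
  functionals on `𝓢` over arbitrary open covers,
  `SchwartzMap.isVanishingOn_iUnion`
  (`LorentzSpectralSupport`), which is why that file is imported here);
* `hasFourierSpectrumIn_iff_fourierSpectrum_subset_holds` — for closed `S`,
  `HasFourierSpectrumIn U S ↔ fourierSpectrum U ⊆ S` (Mathlib's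
  `Distribution.IsVanishingOn.disjoint_dsupport` for `→`);
* `hasFourierSpectrumIn_iff_integral_eq_zero_holds` — the test-function form
  `∫ f(a) ⟪φ, U(a)ψ⟫ da = 0` whenever `supp 𝓕f` misses `−(2π)⁻¹ • S` (substitute `g = 𝓕⁻¹f`,
  `𝓕⁻¹f = 𝓕f(−·)`, `𝓕𝓕g = g(−·)`; Streater–Wightman (3-4)).

## References

* L. Hörmander, *The Analysis of Linear Partial Differential Operators I*, Thm. 2.2.1,
  Def. 2.2.2. [HormanderALPDO1]
* R. F. Streater, A. S. Wightman, *PCT, Spin and Statistics, and All That*, §3-1, eq. (3-4)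
  (spectral condition in test-function form). [StreaterWightman1964]
* M. Reed, B. Simon, *Methods of Modern Mathematical Physics II*, §IX.1. [ReedSimonII1975]
-/

noncomputable section

open MeasureTheory Filter Set
open scoped InnerProductSpace SchwartzMap FourierTransform Topology

namespace Literature.Analysis.UnboundedOperators


/-! ### Vanishing off the support -/

section Sheaf

variable {E : Type*} [NormedAddCommGroup E] [NormedSpace ℝ E] [FiniteDimensional ℝ E]

/-- **A tempered distribution vanishes off its distributional support** (Hörmander I,
Thm. 2.2.1: the complement of the support is the union of the open sets of vanishing).
[cite: HormanderALPDO1, Thm. 2.2.1] -/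
theorem isVanishingOn_compl_dsupport (T : 𝓢(E, ℂ) →L[ℂ] ℂ) :
    Distribution.IsVanishingOn (T : 𝓢(E, ℂ) → ℂ) (Distribution.dsupport (T : 𝓢(E, ℂ) → ℂ))ᶜ := by
  rw [Distribution.dsupport_compl_eq, sUnion_eq_iUnion]
  exact SchwartzMap.isVanishingOn_iUnion
    (fun a => a.2.2) T (fun a => a.2.1)

end Sheaf

/-! ### The Fourier-transformed matrix coefficient as a tempered distribution -/

variable {P : Type*} [NormedAddCommGroup P] [InnerProductSpace ℝ P] [FiniteDimensional ℝ P]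
  [MeasurableSpace P] [BorelSpace P]
variable {H : Type*} [NormedAddCommGroup H] [InnerProductSpace ℂ H] [CompleteSpace H]

namespace UnitaryRep

/-- **The Fourier-transformed matrix coefficient `g ↦ ∫ 𝓕g(a) ⟪φ, U(a)ψ⟫ da` as a tempered
distribution** (a continuous linear functional on `𝓢(P, ℂ)`), bundling the proved facts
`fourierMatrixCoeff_add_holds`, `fourierMatrixCoeff_smul_holds`, `continuous_fourierMatrixCoeff_holds`
(Reed–Simon II, §IX.1). [cite: ReedSimonII1975, §IX.1] -/
def fourierMatrixCoeffCLM (U : UnitaryRep (Multiplicative P) H) (φ ψ : H) : 𝓢(P, ℂ) →L[ℂ] ℂ where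
  toFun := U.fourierMatrixCoeff φ ψ
  map_add' := fourierMatrixCoeff_add_holds U φ ψ
  map_smul' c g := by
    rw [fourierMatrixCoeff_smul_holds U φ ψ c g]
    rfl
  cont := continuous_fourierMatrixCoeff_holds U φ ψ

/-- The bundled functional is the Fourier-transformed matrix coefficient. [folklore] -/
@[simp]
theorem fourierMatrixCoeffCLM_apply (U : UnitaryRep (Multiplicative P) H) (φ ψ : H) (g : 𝓢(P, ℂ)) :
    U.fourierMatrixCoeffCLM φ ψ g = U.fourierMatrixCoeff φ ψ g :=
  rfl

/-- The underlying function of the bundled functional. [folklore] -/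
theorem coe_fourierMatrixCoeffCLM (U : UnitaryRep (Multiplicative P) H) (φ ψ : H) :
    (U.fourierMatrixCoeffCLM φ ψ : 𝓢(P, ℂ) → ℂ) = U.fourierMatrixCoeff φ ψ :=
  rfl

/-! ### The three support facts -/

/-- **`hasFourierSpectrumIn_fourierSpectrum` holds**: each Fourier-transformed matrix coefficient
vanishes off its own distributional support (`isVanishingOn_compl_dsupport`), which lies in the
(rescaled) Fourier spectrum. [cite: HormanderALPDO1, Thm. 2.2.1] -/
theorem hasFourierSpectrumIn_fourierSpectrum_holds :
    hasFourierSpectrumIn_fourierSpectrum (P := P) (H := H) := by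
  intro U φ ψ
  have hv := isVanishingOn_compl_dsupport (U.fourierMatrixCoeffCLM φ ψ)
  rw [coe_fourierMatrixCoeffCLM] at hv
  refine hv.mono ?_
  rw [compl_subset_compl]
  intro ξ hξ
  exact subset_closure ⟨ξ, mem_iUnion.2 ⟨φ, mem_iUnion.2 ⟨ψ, hξ⟩⟩, rfl⟩

/-- **`hasFourierSpectrumIn_iff_fourierSpectrum_subset` holds**: for closed `S`, the spectral
condition `HasFourierSpectrumIn U S` is equivalent to `fourierSpectrum U ⊆ S` (a distribution
vanishing on the open complement of a closed set has support in the set; conversely it vanishes off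
its support). [cite: HormanderALPDO1, Thm. 2.2.1] -/
theorem hasFourierSpectrumIn_iff_fourierSpectrum_subset_holds :
    hasFourierSpectrumIn_iff_fourierSpectrum_subset (P := P) (H := H) := by
  intro U S hS
  constructor
  · intro h
    refine closure_minimal ?_ hS
    rintro _ ⟨ξ, hξ, rfl⟩
    simp only [mem_iUnion] at hξ
    obtain ⟨φ, ψ, hξ⟩ := hξ
    have hopen : IsOpen ((fun ξ : P => (2 * Real.pi) • ξ) ⁻¹' S)ᶜ :=
      (hS.preimage (continuous_const_smul _)).isOpen_compl
    have hdisj := (h φ ψ).disjoint_dsupport hopen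
    by_contra hnot
    exact disjoint_left.1 hdisj hnot hξ
  · intro h
    exact (hasFourierSpectrumIn_fourierSpectrum_holds U).mono h

/-- `𝓕⁻¹f = 𝓕f(−·)` on `𝓢`, as functions. [folklore] -/
theorem coe_fourierInv_eq_comp_neg (f : 𝓢(P, ℂ)) :
    ((𝓕⁻ f : 𝓢(P, ℂ)) : P → ℂ) = ((𝓕 f : 𝓢(P, ℂ)) : P → ℂ) ∘ Homeomorph.neg P := by
  funext y
  rw [congrFun (SchwartzMap.fourierInv_coe f) y, Real.fourierInv_eq_fourier_neg]
  rfl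

/-- `𝓕𝓕g = g(−·)` on `𝓢`, as functions. [folklore] -/
theorem coe_fourier_fourier_eq_comp_neg (g : 𝓢(P, ℂ)) :
    ((𝓕 (𝓕 g : 𝓢(P, ℂ)) : 𝓢(P, ℂ)) : P → ℂ) = (g : P → ℂ) ∘ Homeomorph.neg P := by
  funext y
  have h0 : (𝓕⁻ (𝓕 g : 𝓢(P, ℂ)) : 𝓢(P, ℂ)) = g := FourierTransform.fourierInv_fourier_eq g
  have h : (𝓕⁻ (𝓕 g : 𝓢(P, ℂ)) : 𝓢(P, ℂ)) (-y) = g (-y) := by rw [h0]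
  rw [congrFun (SchwartzMap.fourierInv_coe _) (-y), Real.fourierInv_eq_fourier_neg, neg_neg] at h
  exact h

/-- **`hasFourierSpectrumIn_iff_integral_eq_zero` holds**: the spectral condition in the
test-function form `∫ f(a) ⟪φ, U(a)ψ⟫ da = 0` for all Schwartz `f` whose Fourier transform is
supported away from `−(2π)⁻¹ • S` (Streater–Wightman (3-4)); substitute `g = 𝓕⁻¹ f`, using
`𝓕⁻¹f = 𝓕f(−·)` and `𝓕𝓕g = g(−·)`. [cite: StreaterWightman1964, §3-1 eq. (3-4)] -/
theorem hasFourierSpectrumIn_iff_integral_eq_zero_holds :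
    hasFourierSpectrumIn_iff_integral_eq_zero (P := P) (H := H) := by
  intro U S
  constructor
  · intro h φ ψ f hf
    have key : U.fourierMatrixCoeff φ ψ (𝓕⁻ f) = ∫ a, f a * U.matrixCoeff φ ψ a := by
      rw [fourierMatrixCoeff_apply, FourierTransform.fourier_fourierInv_eq]
    rw [← key]
    refine h φ ψ (𝓕⁻ f) fun x hx => ?_
    rw [coe_fourierInv_eq_comp_neg, tsupport_comp_eq_preimage] at hx
    -- `hx : -x ∈ tsupport (𝓕 f)`; goal: `2π • x ∉ S`
    intro hxS
    refine disjoint_left.1 hf hx ?_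
    show (-(2 * Real.pi)) • ((Homeomorph.neg P) x) ∈ S
    simpa [smul_neg, neg_smul] using hxS
  · intro h φ ψ g hg
    refine h φ ψ (𝓕 g) (disjoint_left.2 fun y hy hyS => ?_)
    rw [coe_fourier_fourier_eq_comp_neg, tsupport_comp_eq_preimage] at hy
    -- `hy : -y ∈ tsupport g`, hence `2π • (-y) ∉ S`; but `hyS : (−2π) • y ∈ S`
    have hy' := hg hy
    apply hy'
    show (2 * Real.pi) • ((Homeomorph.neg P) y) ∈ S
    simpa [smul_neg, neg_smul] using hyS

end UnitaryRep

end Literature.Analysis.UnboundedOperators
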